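/-
COR-CM (cell pub-hodgecm2, stage 2 of the Hodge ladder) — count-neutral KERNEL COMBINATORICS «the index-two cyclic law», part XXIII: THE MIXED TWISTS,
IV — THE OCTIC TWIST TYPE `ℤ/4j ⋊_{2j+1} ℤ/2 = D₄ × C_j` REALISED (seat prover-pub-hodgecm2-b23-g56-0, binder prover b23, gen 56; claim «INDEX-TWO CYCLIC —
THE MIXED TWISTS», HOME/INBOX.md l.26438).  Theorems only (the type is part VIIʼs `SplitGroup (2j) (2j+1)`), on parts VII, XX–XXII and
seat b23 gen 45ʼs block count BY NAME; no `decide` beyond numerals, no certificate, no named fact, no `sorry`; `Interfaces.lean` (C1), every E term, B01,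
`Transposition/*`, `PortJoin/*`, `D2Bridge/*` untouched.
HONEST FRAMING: `HC_CM` is NOT proved, here or anywhere in the tree; nothing here is a period, a count of record or a headline.
T5: INHABITATION — the hypothesis set of parts XXI/XXII («c ∉ ⟨u^{r+1}⟩, u^{r+1} ≠ 1, n = 2·orderOf u^{r+1}») holds on Mathlibʼs semidirect product
`Multiplicative (ZMod 4j) ⋊ Multiplicative (ZMod 2)` with twist `2j+1`, `j` odd `≥ 3` (checker: self, this file).
-/
import Summits.HodgeConjecture.CorCM.Census.IndexTwoCyclicMixedLaw
import Summits.HodgeConjecture.CorCM.Census.IndexTwoCyclicInstance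
import Summits.HodgeConjecture.CorCM.Census.OcticProductBlockCount

/-!
# The index-two cyclic law, XXIII: the mixed twists, IV — the octic twist type `ℤ/4j ⋊_{2j+1} ℤ/2` and the row `(12, 7)`

* §1 two generic complements to part XX: **`c ∉ ⟨v⟩ ⟺ orderOf v` odd** (`notMem_zpowers_twist_of_odd`, converse of `odd_orderOf_twist`), and the
  closed form **`orderOf u^{r+1} = 2n / gcd(2n, r+1)`** (`orderOf_twist_eq_div_gcd`).
* §2 **THE OCTIC TWIST TYPE** `SplitGroup (2j) (2j+1) = ℤ/4j ⋊_{2j+1} ℤ/2` (`j` odd): `r = 2j+1 ≡ 3 (mod 4)`, `≡ 1 (mod j)`, `r² = 4j(j+1) + 1 ≡ 1`; on it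
  `gcd(4j, 2j+2) = 4`, so `orderOf u^{r+1} = j`, `c ∉ ⟨u^{r+1}⟩`, and for `j ≥ 3` the octic-level hypotheses of part XXI hold:
  **`μ = φ₂ = β − 2` on it for every odd `j ≥ 3`** (`isLeast_card_gfaces_generate_fibreTwo_octicType`) — `D₄ × C_j` as a split index-two cyclic
  group.  Row **`(12, 7) = D₄ × C₃`: `β = 184` (gen 45ʼs count through part XXIʼs octic product datum), `μ = 182`**.
* §3 the first OPEN mixed row in this language: on `ℤ/24 ⋊₇ ℤ/2 = D(ℤ/8) × C₃` the twist element has order `3`, the dihedral factor order `16`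
  (`orderOf_twist_splitGroup_twentyfour_seven`), so parts XXI/XXII do not apply; part IX gives `β − 2 ≤ μ ≤ β − 1` there.

## References
* [Pohlmann1968] H. Pohlmann, Algebraic cycles on abelian varieties of complex multiplication type, Ann. of Math. 88 (1968), Thm 1.
* [Milne1999] J. S. Milne, Lefschetz motives and the Tate conjecture, Compositio Math. 117 (1999), Prop. 2.1, p. 54.
-/

namespace Summit.HodgeConjecture.CorCM.Census.IndexTwoCyclic

open Finset
open Summit.HodgeConjecture.CorCM.Prior.AllgGroup.RfwfAllgGroup
open Summit.HodgeConjecture.CorCM.Census.BlockParity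
open Summit.HodgeConjecture.CorCM.Census.Coinvariant

noncomputable section

/-! ## §1 Two generic complements -/

section Generic

variable {G : Type*} [Group G] [Fintype G] [DecidableEq G] {c : G} {n : ℕ} [NeZero n]
variable (D : Datum G c n)

omit [Fintype G] [DecidableEq G] [NeZero n] in
/-- **`orderOf v` odd ⟹ `c ∉ ⟨v⟩`** (`c` has order `2`). [folklore] -/
theorem notMem_zpowers_twist_of_odd (hc2 : c * c = 1) (hc1 : c ≠ 1) (hodd : Odd (orderOf (D.u ^ (D.r + 1)))) :
    c ∉ Subgroup.zpowers (D.u ^ (D.r + 1)) := fun h => by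
  have h2 : orderOf c = 2 := orderOf_eq_prime (by rw [pow_two, hc2]) hc1
  have hdvd := orderOf_dvd_of_mem_zpowers h
  rw [h2] at hdvd
  exact hodd.not_two_dvd_nat hdvd

omit [Fintype G] [DecidableEq G] [NeZero n] in
/-- **`orderOf u^{r+1} = 2n / gcd(2n, r+1)`.** [folklore] -/
theorem orderOf_twist_eq_div_gcd : orderOf (D.u ^ (D.r + 1)) = 2 * n / Nat.gcd (2 * n) (D.r + 1) := by
  rw [orderOf_pow' D.u (Nat.succ_ne_zero D.r), D.hord]

end Generic

/-! ## §2 The octic twist type `ℤ/4j ⋊_{2j+1} ℤ/2` -/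

section Octic

variable (j : ℕ) [NeZero j]

omit [NeZero j] in
/-- `(2j+1)² = 1` in `ℤ/4j`. [folklore] -/
theorem oTwist_sq : ((2 * j + 1 : ℕ) : ZMod (2 * (2 * j))) * ((2 * j + 1 : ℕ) : ZMod (2 * (2 * j))) = 1 := by
  rw [← Nat.cast_mul, show (2 * j + 1) * (2 * j + 1) = (2 * (2 * j)) * (j + 1) + 1 by ring, Nat.cast_add, Nat.cast_mul, ZMod.natCast_self,
    zero_mul, zero_add, Nat.cast_one]

/-- The twisting exponent of the datum on `ℤ/4j ⋊_{2j+1} ℤ/2` is `2j + 1`. [folklore] -/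
theorem r_oType : (splitDatum (2 * j) ((2 * j + 1 : ℕ) : ZMod (2 * (2 * j))) (oTwist_sq j)).r = 2 * j + 1 := by
  change (((2 * j + 1 : ℕ) : ZMod (2 * (2 * j)))).val = 2 * j + 1
  rw [ZMod.val_natCast]
  have hj := NeZero.ne j
  exact Nat.mod_eq_of_lt (by omega)

/-- `gcd(4j, 2j+2) = 4` for odd `j`. [folklore] -/
theorem gcd_four_mul_two_mul_add_two (hj : Odd j) : Nat.gcd (2 * (2 * j)) (2 * j + 1 + 1) = 4 := by
  obtain ⟨m, rfl⟩ := hj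
  have e1 : 2 * (2 * (2 * m + 1)) = 4 * (2 * m + 1) := by ring
  have e2 : 2 * (2 * m + 1) + 1 + 1 = 4 * (m + 1) := by ring
  rw [e1, e2, Nat.gcd_mul_left]
  have h : Nat.gcd (2 * m + 1) (m + 1) = 1 := by
    rw [show 2 * m + 1 = (m + 1) * 1 + m by ring, Nat.gcd_comm, Nat.gcd_mul_left_add_right, Nat.gcd_comm]
    exact (Nat.coprime_self_add_right.mpr (Nat.coprime_one_right m))
  rw [h, mul_one]

/-- **On `ℤ/4j ⋊_{2j+1} ℤ/2` (`j` odd) the twist element `u^{r+1} = u^{2j+2}` has order `j`.** [folklore] -/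
theorem orderOf_twist_oType (hj : Odd j) :
    orderOf ((splitDatum (2 * j) ((2 * j + 1 : ℕ) : ZMod (2 * (2 * j))) (oTwist_sq j)).u ^
      ((splitDatum (2 * j) ((2 * j + 1 : ℕ) : ZMod (2 * (2 * j))) (oTwist_sq j)).r + 1)) = j := by
  rw [orderOf_twist_eq_div_gcd, r_oType, gcd_four_mul_two_mul_add_two j hj]
  have hj0 := NeZero.ne j
  omega

/-- **`μ = φ₂` ON THE OCTIC TWIST TYPE `ℤ/4j ⋊_{2j+1} ℤ/2 = D₄ × C_j`, every odd `j ≥ 3`** (part XXI on Mathlibʼs semidirect product). [folklore] -/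
theorem isLeast_card_gfaces_generate_fibreTwo_octicType (hj : Odd j) (h3 : 3 ≤ j) :
    IsLeast {m : ℕ | ∃ S : Finset (CMF (SplitGroup (2 * j) ((2 * j + 1 : ℕ) : ZMod (2 * (2 * j))) (oTwist_sq j)) (SemidirectProduct.inl (Multiplicative.ofAdd ((2 * j : ℕ) : ZMod (2 * (2 * j))))) →₀ ℤ),
      ↑S ⊆ gfaceSet (SplitGroup (2 * j) ((2 * j + 1 : ℕ) : ZMod (2 * (2 * j))) (oTwist_sq j)) _ (splitC_mul_self (2 * j) _ (oTwist_sq j)) ∧ S.card = m ∧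
      hodgeSpan _ (splitC_mul_self (2 * j) _ (oTwist_sq j)) ≤ Submodule.span ℤ (pairSet _) ⊔ Submodule.span ℤ (translates _ S)}
      (fibreTwo (SemidirectProduct.inl (Multiplicative.ofAdd ((2 * j : ℕ) : ZMod (2 * (2 * j)))) : SplitGroup (2 * j) ((2 * j + 1 : ℕ) : ZMod (2 * (2 * j))) (oTwist_sq j))
        (splitC_mul_self (2 * j) _ (oTwist_sq j))) := by
  set D := splitDatum (2 * j) ((2 * j + 1 : ℕ) : ZMod (2 * (2 * j))) (oTwist_sq j) with hD
  have hord : orderOf (D.u ^ (D.r + 1)) = j := orderOf_twist_oType j hj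
  have hodd : Odd (orderOf (D.u ^ (D.r + 1))) := by rw [hord]; exact hj
  refine isLeast_card_gfaces_generate_fibreTwo_of_octic_level D (splitC_mul_self (2 * j) _ _) (splitC_ne_one (2 * j) _ _)
    (notMem_zpowers_twist_of_odd D (splitC_mul_self (2 * j) _ _) (splitC_ne_one (2 * j) _ _) hodd) (fun h => ?_) (by rw [hord])
  have h1 : orderOf (D.u ^ (D.r + 1)) = 1 := by rw [h, orderOf_one]
  omega

/-- **Block currency `μ = β − 2` on the octic twist type.** [folklore] -/
theorem isLeast_card_gfaces_generate_octicType (hj : Odd j) (h3 : 3 ≤ j) :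
    IsLeast {m : ℕ | ∃ S : Finset (CMF (SplitGroup (2 * j) ((2 * j + 1 : ℕ) : ZMod (2 * (2 * j))) (oTwist_sq j)) (SemidirectProduct.inl (Multiplicative.ofAdd ((2 * j : ℕ) : ZMod (2 * (2 * j))))) →₀ ℤ),
      ↑S ⊆ gfaceSet (SplitGroup (2 * j) ((2 * j + 1 : ℕ) : ZMod (2 * (2 * j))) (oTwist_sq j)) _ (splitC_mul_self (2 * j) _ (oTwist_sq j)) ∧ S.card = m ∧
      hodgeSpan _ (splitC_mul_self (2 * j) _ (oTwist_sq j)) ≤ Submodule.span ℤ (pairSet _) ⊔ Submodule.span ℤ (translates _ S)}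
      (Fintype.card (Block (SemidirectProduct.inl (Multiplicative.ofAdd ((2 * j : ℕ) : ZMod (2 * (2 * j)))) : SplitGroup (2 * j) ((2 * j + 1 : ℕ) : ZMod (2 * (2 * j))) (oTwist_sq j))) - 2) := by
  set D := splitDatum (2 * j) ((2 * j + 1 : ℕ) : ZMod (2 * (2 * j))) (oTwist_sq j) with hD
  have hord : orderOf (D.u ^ (D.r + 1)) = j := orderOf_twist_oType j hj
  have hodd : Odd (orderOf (D.u ^ (D.r + 1))) := by rw [hord]; exact hj
  refine isLeast_card_gfaces_generate_of_octic_level D (splitC_mul_self (2 * j) _ _) (splitC_ne_one (2 * j) _ _)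
    (notMem_zpowers_twist_of_odd D (splitC_mul_self (2 * j) _ _) (splitC_ne_one (2 * j) _ _) hodd) (fun h => ?_) (by rw [hord])
  have h1 : orderOf (D.u ^ (D.r + 1)) = 1 := by rw [h, orderOf_one]
  omega

/-! ### The row `(12, 7) = D₄ × C₃` -/

/-- **`β(ℤ/12 ⋊₇ ℤ/2, u⁶) = 184`** (seat b23 gen 45ʼs count of `D₄ × ℤ/3` through part XXIʼs octic product datum). [folklore] -/
theorem card_block_oType_three :
    Fintype.card (Block (SemidirectProduct.inl (Multiplicative.ofAdd ((2 * 3 : ℕ) : ZMod (2 * (2 * 3)))) : SplitGroup (2 * 3) ((2 * 3 + 1 : ℕ) : ZMod (2 * (2 * 3))) (oTwist_sq 3))) = 184 := by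
  set D := splitDatum (2 * 3) ((2 * 3 + 1 : ℕ) : ZMod (2 * (2 * 3))) (oTwist_sq 3) with hD
  have hj : Odd 3 := by decide
  have hord : orderOf (D.u ^ (D.r + 1)) = 3 := orderOf_twist_oType 3 hj
  have hodd : Odd (orderOf (D.u ^ (D.r + 1))) := by rw [hord]; exact hj
  have hne := nonempty_octicProductDatum D (splitC_mul_self (2 * 3) _ _) (splitC_ne_one (2 * 3) _ _)
    (notMem_zpowers_twist_of_odd D (splitC_mul_self (2 * 3) _ _) (splitC_ne_one (2 * 3) _ _) hodd) (by rw [hord])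
  rw [hord] at hne
  obtain ⟨E⟩ := hne
  exact OcticProduct.card_block_eq_oneHundredEightyFour E (splitC_mul_self (2 * 3) _ _)

/-- **Row `(12, 7)`: `μ(ℤ/12 ⋊₇ ℤ/2, u⁶) = 182 = β − 2`** — the smallest mixed twist, here as a split index-two cyclic group. [folklore] -/
theorem isLeast_card_gfaces_generate_oType_three :
    IsLeast {m : ℕ | ∃ S : Finset (CMF (SplitGroup (2 * 3) ((2 * 3 + 1 : ℕ) : ZMod (2 * (2 * 3))) (oTwist_sq 3)) (SemidirectProduct.inl (Multiplicative.ofAdd ((2 * 3 : ℕ) : ZMod (2 * (2 * 3))))) →₀ ℤ),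
      ↑S ⊆ gfaceSet (SplitGroup (2 * 3) ((2 * 3 + 1 : ℕ) : ZMod (2 * (2 * 3))) (oTwist_sq 3)) _ (splitC_mul_self (2 * 3) _ (oTwist_sq 3)) ∧ S.card = m ∧
      hodgeSpan _ (splitC_mul_self (2 * 3) _ (oTwist_sq 3)) ≤ Submodule.span ℤ (pairSet _) ⊔ Submodule.span ℤ (translates _ S)} 182 := by
  have h := isLeast_card_gfaces_generate_octicType 3 (by decide) le_rfl
  rwa [card_block_oType_three] at h

end Octic

/-! ## §3 The first open mixed row `(24, 7) = D(ℤ/8) × C₃` -/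

/-- `7² = 1` in `ℤ/24`. [folklore] -/
theorem seven_sq_twentyfour : ((7 : ℕ) : ZMod (2 * 12)) * ((7 : ℕ) : ZMod (2 * 12)) = 1 := by decide

/-- **On `ℤ/24 ⋊₇ ℤ/2 = D(ℤ/8) × C₃` the twist element `u⁸` has order `3` and the dihedral factor `⟨u³, w⟩` order `16`**: the row is on the
mixed side (`c ∉ ⟨u⁸⟩`) but NOT at the octic level (`n = 12 ≠ 2·3`) — the smallest row of the column not closed by parts VI/XI/XXI. [folklore] -/
theorem orderOf_twist_splitGroup_twentyfour_seven :
    orderOf ((splitDatum 12 ((7 : ℕ) : ZMod (2 * 12)) seven_sq_twentyfour).u ^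
        ((splitDatum 12 ((7 : ℕ) : ZMod (2 * 12)) seven_sq_twentyfour).r + 1)) = 3 ∧
      (SemidirectProduct.inl (Multiplicative.ofAdd ((12 : ℕ) : ZMod (2 * 12))) : SplitGroup 12 ((7 : ℕ) : ZMod (2 * 12)) seven_sq_twentyfour) ∉
        Subgroup.zpowers ((splitDatum 12 ((7 : ℕ) : ZMod (2 * 12)) seven_sq_twentyfour).u ^
          ((splitDatum 12 ((7 : ℕ) : ZMod (2 * 12)) seven_sq_twentyfour).r + 1)) ∧
      orderOf ((splitDatum 12 ((7 : ℕ) : ZMod (2 * 12)) seven_sq_twentyfour).u ^ 3) = 8 := by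
  set D := splitDatum 12 ((7 : ℕ) : ZMod (2 * 12)) seven_sq_twentyfour with hD
  have hr : D.r = 7 := by
    change (((7 : ℕ) : ZMod (2 * 12))).val = 7
    rw [ZMod.val_natCast]
  have hord : orderOf (D.u ^ (D.r + 1)) = 3 := by
    rw [orderOf_twist_eq_div_gcd, hr]; decide
  refine ⟨hord, notMem_zpowers_twist_of_odd D (splitC_mul_self 12 _ _) (splitC_ne_one 12 _ _) (by rw [hord]; decide), ?_⟩
  rw [orderOf_pow' D.u (by norm_num), D.hord]; decide

end

end Summit.HodgeConjecture.CorCM.Census.IndexTwoCyclic
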